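import Mathlib
import Summits.ValiantsHypothesis.ValiantsHypothesis.Cruxes.OrbitDimensionBound.Lines.RowTorusLadder

/-!
# F3 SPECIAL-CASE WITNESSES for the rung `RowTorus.RowShadow` (line `row_torus`)

(a) the FLOOR is the family member `ℓ = 2^r` — by `simpa` from the seed theorem (in fact `Iff.rfl`);
(b) the floor's parameter value of the SHADOW form (the rung's shape) is a theorem ONE line from the seed;
(c) rung ⇒ floor in both forms (numeric and shadow), one line each;
(d) the relaxed symmetrisation target is implied by the host crux, one line.
[cite: LandsbergRessayre2017, Thm. 2.8]
-/

set_option linter.dupNamespace false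

namespace Summit.ValiantsHypothesis.ValiantsHypothesis.Cruxes.OrbitDimensionBound.RowTorus.Special

open Literature.Computability.AlgebraicComplexity
open Summit.ValiantsHypothesis.ValiantsHypothesis.Cruxes.OrbitDimensionBound.Confusion
open Summit.ValiantsHypothesis.ValiantsHypothesis.Cruxes.OrbitDimensionBound.RowTorus

/-- (a) the floor is LITERALLY the member `ℓ = 2^r` of the family. [cite: LandsbergRessayre2017, Thm. 2.8] -/
example : CoveringRung (fun _ r _ => 2 ^ r) :=
  -- definitional unfolding: `CoveringRung (fun _ r _ => 2^r)` δβ-reduces to the seed statement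
  Summit.ValiantsHypothesis.ValiantsHypothesis.Theorems.FreeSubtorusSubtorusCovering.subtorusCovering_proof

/-- (a') … and by `exact` (the identification is `Iff.rfl`). [cite: LandsbergRessayre2017, Thm. 2.8] -/
example : CoveringRung powLoss :=
  Summit.ValiantsHypothesis.ValiantsHypothesis.Theorems.FreeSubtorusSubtorusCovering.subtorusCovering_proof

/-- (b) the rung's SHAPE (`CoveringShadow ℓ`) at the floor's parameter `ℓ = 2^r` is a theorem, one line from the seed
(+ the tree's `not_isPBounded_choose_middle`). [cite: LandsbergRessayre2017, Thm. 2.8] -/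
theorem powShadow_of_seed : CoveringShadow powLoss :=
  coveringShadow_of_coveringRung not_isPBounded_choose_middle
    Summit.ValiantsHypothesis.ValiantsHypothesis.Theorems.FreeSubtorusSubtorusCovering.subtorusCovering_proof

/-- (c) rung ⇒ floor, numeric form. [cite: LandsbergRessayre2017, Thm. 2.8] -/
example (h : RowRankCovering) :
    Summit.ValiantsHypothesis.ValiantsHypothesis.Theses.FreeSubtorus.SubtorusCovering :=
  subtorusCovering_of_rowRankCovering h

/-- (c') rung ⇒ floor, shadow form. [cite: LandsbergRessayre2017, Thm. 2.8] -/
example (h : RowShadow) : CoveringShadow powLoss :=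
  powShadow_of_rowShadow h

/-- (c'') at lattice data whose row halves are ℚ-independent (`rk Λ_R = r`) the rung's bound IS the floor's bound
pointwise: `m · 2^{rk Λ_R} = m · 2^r`. [folklore] -/
example (n m r : ℕ) (Λ : Fin r → (Fin n ⊕ Fin n) → ℤ) (h : rowRank n r Λ = r) :
    m * rowLoss n r Λ = m * powLoss n r Λ := by
  simp [rowLoss, powLoss, h]

/-- (d) the relaxed symmetrisation target follows from the host crux. [cite: LandsbergRessayre2017, Question 2.2] -/
example (h : Summit.ValiantsHypothesis.ValiantsHypothesis.Theses.FreeSubtorus.OrbitDimensionBound) : OrbitRowBound :=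
  orbitRowBound_of_orbitDimensionBound h

end Summit.ValiantsHypothesis.ValiantsHypothesis.Cruxes.OrbitDimensionBound.RowTorus.Special
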